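import Summits.SmoothPoincare4.SmoothPoincare4.Theorems.ConvexBisectionAcyclicBisectionExistsPageRotationFlowFix
import Mathlib.Analysis.ODE.ExistUnique
import Mathlib.Analysis.SpecialFunctions.Complex.LogDeriv
import Mathlib.Analysis.Calculus.ContDiff.RCLike
import HarnessLib

/-!
# The page-rotation schedule: re-spacing the prefix pages `pageDir (m+n) i ↦ pageDir m i`
(brick T1b-1 of stub `stub_steinRealisation` = NF6
`Literature.Geometry.Symplectic.steinRealisation_of_sorted_modelsOnFibred`, line `modp-braid-orbits`
r11, crux `ConvexBisection.AcyclicBisectionExists`, item stmt-SmoothPoincare4-10508; registered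
sub-goal `helper_exists_pageRotation`)

NF6 realises a sorted fibred model `P ++ N` (`m = |P| ≥ 1`, `n = |N|`) with the prefix attaching
circles in the pages of directions `pageDir (m+n) i = e^{−2πi(i+½)/(m+n)}` of `Base g`, while
`IsLefschetzLink g P` wants them at `pageDir m i`.  `helper_exists_pageRotation` is the ambient
isotopy `R` of `Base g` re-spacing the pages: `rho`-preserving, FIBRED (at each time every page is
carried into one page), and `R₁ (page (pageDir (m+n) i)) ⊆ page (pageDir m i)` for `i < m`.  It is
ONE flow of the profiled page-rotation field (`helper_rotFlow_fix`, along which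
`(w ∘ γ)' = a(w) i w` and `‖x‖² < 4`, `‖w‖` are invariant) with the **dilation profile**
`a = λ · cwAngle · rayCut δ` (§1–§2): `cwAngle z = arg(−z) − π ∈ (−2π, 0]` is the clockwise angle
(cut along the unused direction `0`), `rayCut δ` a smooth cut-off vanishing on a half-strip around
that ray — so `a` is smooth on `ℂ` — and equal to `1` on the arc of prefix directions,
`λ = log((m+n)/m)`.  On that arc the clockwise angle `φ` of a flow line obeys `φ' = λ φ`, so
`φ(t) = α e^{λt}` and `−2π(i+½)/(m+n) ↦ −2π(i+½)/m` at `t = 1` (§4: explicit solution `solFn`,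
arc estimate `angleFn_mem_Icc`, trigonometric separation `cos_le_or_sin_sq_ge` from the cut).
Fibredness and the identification with the explicit solution are UNIQUENESS for the autonomous
ODE `ζ' = a(ζ) i ζ` in the closed unit disc (§3: `C¹ ⇒` Lipschitz on a compact convex set, Mathlib
`ODE_solution_unique_univ` / `…_of_mem_Icc_right`).  Everything is proved; no named facts, no
`sorry`.  References: R. İ. Baykur, *Kähler decomposition of 4-manifolds*, AGT 6 (2006), proof of
Thm. 5.1, pp. 13–14 [Baykur2006]; Gompf–Stipsicz (1999), §8.2; J. M. Lee, *Introduction to Smooth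
Manifolds* (2012), Thm. 9.12 [LeeSmoothManifolds2013].
-/

noncomputable section

set_option linter.dupNamespace false

open scoped Manifold ContDiff Topology Real
open Set Function Metric
open Literature.Topology.FourManifolds Literature.Topology.FourManifolds.LefschetzBase

namespace Summit.SmoothPoincare4.SmoothPoincare4.Theorems.AcyclicBisectionExists.ModpBraidOrbits

/-! ## §1 A smooth cut-off vanishing near the ray `ℝ≥0 ⊂ ℂ` -/

/-- The ray cut-off `1 − S((Re z + 2δ)/δ) · S((4δ² − (Im z)²)/(3δ²))` (`S = smoothTransition`):
`0` on the half-strip `{Re z ≥ −δ, |Im z| ≤ δ}` around the ray `ℝ≥0`, `1` off the half-strip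
`{Re z > −2δ, |Im z| < 2δ}`. [folklore] -/
def rayCut (δ : ℝ) (z : ℂ) : ℝ :=
  1 - Real.smoothTransition ((z.re + 2 * δ) / δ) *
    Real.smoothTransition ((4 * δ ^ 2 - z.im ^ 2) / (3 * δ ^ 2))

/-- The ray cut-off is smooth. [folklore] -/
theorem contDiff_rayCut (δ : ℝ) : ContDiff ℝ ∞ (rayCut δ) := by
  have h1 : ContDiff ℝ ∞ fun z : ℂ => (z.re + 2 * δ) / δ :=
    (Complex.reCLM.contDiff.add contDiff_const).div_const _
  have h2 : ContDiff ℝ ∞ fun z : ℂ => (4 * δ ^ 2 - z.im ^ 2) / (3 * δ ^ 2) :=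
    (contDiff_const.sub (Complex.imCLM.contDiff.pow 2)).div_const _
  exact contDiff_const.sub
    (((Real.smoothTransition.contDiff (n := ⊤)).comp h1).mul
      ((Real.smoothTransition.contDiff (n := ⊤)).comp h2))

/-- The ray cut-off vanishes on the closed half-strip `{Re z ≥ −δ, (Im z)² ≤ δ²}`. [folklore] -/
theorem rayCut_eq_zero {δ : ℝ} (hδ : 0 < δ) {z : ℂ} (hre : -δ ≤ z.re) (him : z.im ^ 2 ≤ δ ^ 2) :
    rayCut δ z = 0 := by
  rw [rayCut, Real.smoothTransition.one_of_one_le, Real.smoothTransition.one_of_one_le, mul_one,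
    sub_self]
  · rw [le_div_iff₀ (by positivity)]; nlinarith
  · rw [le_div_iff₀ hδ]; linarith

/-- The ray cut-off equals `1` on `{Re z ≤ −2δ}`. [folklore] -/
theorem rayCut_eq_one_of_re {δ : ℝ} (hδ : 0 < δ) {z : ℂ} (hre : z.re ≤ -(2 * δ)) :
    rayCut δ z = 1 := by
  rw [rayCut, Real.smoothTransition.zero_of_nonpos, zero_mul, sub_zero]
  exact div_nonpos_of_nonpos_of_nonneg (by linarith) hδ.le

/-- The ray cut-off equals `1` on `{(Im z)² ≥ 4δ²}`. [folklore] -/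
theorem rayCut_eq_one_of_im {δ : ℝ} {z : ℂ} (him : 4 * δ ^ 2 ≤ z.im ^ 2) : rayCut δ z = 1 := by
  rw [rayCut, Real.smoothTransition.zero_of_nonpos (x := (4 * δ ^ 2 - z.im ^ 2) / (3 * δ ^ 2)),
    mul_zero, sub_zero]
  exact div_nonpos_of_nonpos_of_nonneg (by linarith) (by positivity)

/-! ## §2 The clockwise angle and the dilation profile -/

/-- The clockwise angle `arg(−z) − π ∈ (−2π, 0]` of `z`: the branch of the argument cut along the
ray `ℝ≥0`, so that `cwAngle (r e^{iφ}) = φ` for `φ ∈ (−2π, 0]`. [folklore] -/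
def cwAngle (z : ℂ) : ℝ := Complex.arg (-z) - π

/-- The clockwise angle of `e^{iφ}/2` is `φ` for `φ ∈ (−2π, 0]`. [folklore] -/
theorem cwAngle_exp_div_two {φ : ℝ} (hφ : φ ∈ Ioc (-(2 * π)) 0) :
    cwAngle (Complex.exp (φ * Complex.I) / 2) = φ := by
  have e : -(Complex.exp (φ * Complex.I) / 2) =
      ((1 / 2 : ℝ) : ℂ) * Complex.exp (((φ + π : ℝ) : ℂ) * Complex.I) := by
    push_cast; rw [add_mul, Complex.exp_add, Complex.exp_pi_mul_I]; ring
  have him : (((φ + π : ℝ) : ℂ) * Complex.I).im = φ + π := by simp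
  rw [cwAngle, e, Complex.arg_real_mul _ (by norm_num), Complex.arg_exp, him,
    (toIocMod_eq_self _).2]
  · ring
  · exact ⟨by linarith [hφ.1], by linarith [hφ.2]⟩

/-- The clockwise angle is smooth off the ray `ℝ≥0` (it is `Im log(−z) − π`). [folklore] -/
theorem contDiffAt_cwAngle {z : ℂ} (hz : -z ∈ Complex.slitPlane) : ContDiffAt ℝ ∞ cwAngle z := by
  have h1 : ContDiffAt ℝ ∞ (fun u : ℂ => Complex.log (-u)) z :=
    ((Complex.contDiffAt_log hz).restrict_scalars ℝ).comp z contDiff_neg.contDiffAt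
  have h2 : ContDiffAt ℝ ∞ (fun u : ℂ => (Complex.log (-u)).im - π) z :=
    (Complex.imCLM.contDiff.contDiffAt.comp z h1).sub contDiffAt_const
  exact h2.congr_of_eventuallyEq (.of_forall fun u => by simp [cwAngle, Complex.log_im])

/-- **The dilation profile** `λ · cwAngle · rayCut δ`: where the cut-off is `1` the angular speed
is `λ` times the clockwise angle, so the clockwise angle of a flow line grows like `e^{λ t}`
("dilation of the clockwise angle"). [folklore] -/
def dilProfile (lam δ : ℝ) (z : ℂ) : ℝ := lam * (cwAngle z * rayCut δ z)

/-- The dilation profile is smooth on `ℂ` (the cut-off kills the branch cut of the angle).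
[folklore] -/
theorem contDiff_dilProfile (lam : ℝ) {δ : ℝ} (hδ : 0 < δ) : ContDiff ℝ ∞ (dilProfile lam δ) := by
  refine contDiff_iff_contDiffAt.2 fun z => ?_
  by_cases h : -δ < z.re ∧ z.im ^ 2 < δ ^ 2
  · have hU : IsOpen {u : ℂ | -δ < u.re ∧ u.im ^ 2 < δ ^ 2} :=
      (isOpen_lt continuous_const Complex.continuous_re).inter
        (isOpen_lt (Complex.continuous_im.pow 2) continuous_const)
    refine (contDiffAt_const (c := (0 : ℝ))).congr_of_eventuallyEq ?_
    filter_upwards [hU.mem_nhds h] with u hu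
    rw [dilProfile, rayCut_eq_zero hδ hu.1.le hu.2.le, mul_zero, mul_zero]
  · have hz : -z ∈ Complex.slitPlane := by
      rw [Complex.mem_slitPlane_iff, Complex.neg_re, Complex.neg_im]
      rcases not_and_or.1 h with h | h
      · left; linarith [not_lt.1 h]
      · refine Or.inr fun h0 => h ?_
        rw [neg_eq_zero.1 h0]
        simpa using pow_pos hδ 2
    exact contDiffAt_const.mul ((contDiffAt_cwAngle hz).mul (contDiff_rayCut δ).contDiffAt)

/-! ## §3 The page-coordinate ODE `ζ' = a(ζ) · i · ζ`: Lipschitz bound and uniqueness -/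

/-- The right-hand side `a(ζ) · i · ζ` of the ODE satisfied by the page coordinate `w` along the
flow lines of `rotFieldA g a` (`hasDerivAt_w_flowline`). [folklore] -/
def rotODE (a : ℂ → ℝ) (ζ : ℂ) : ℂ := (a ζ : ℂ) * (Complex.I * ζ)

/-- The right-hand side is smooth, hence Lipschitz on the closed unit disc (`C¹` on a compact
convex set). [folklore] -/
theorem exists_lipschitzOnWith_rotODE {a : ℂ → ℝ} (ha : ContDiff ℝ ∞ a) :
    ∃ K, LipschitzOnWith K (rotODE a) (closedBall 0 1) :=
  ((Complex.ofRealCLM.contDiff.comp ha).mul (contDiff_const.mul contDiff_id) :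
    ContDiff ℝ ∞ (rotODE a)).contDiffOn.exists_lipschitzOnWith (by simp) (convex_closedBall 0 1)
    (isCompact_closedBall 0 1)

section Flow

variable {g : ℕ} {a : ℂ → ℝ} {θ : ℝ × EuclideanSpace ℝ (Fin 4) → EuclideanSpace ℝ (Fin 4)}
  (hder : ∀ x t, HasDerivAt (fun t => θ (t, x)) (rotFieldA g a (θ (t, x))) t)
  (h0 : ∀ x, θ (0, x) = x)
include hder h0

/-- Along the flow, the page coordinate of a point of `{rho ≤ 3/10}` stays in the closed unit
disc (`‖w‖` is invariant and `‖w‖² ≤ rho ≤ 3/10`). [folklore] -/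
theorem w_flow_mem_closedBall {x : EuclideanSpace ℝ (Fin 4)} (hx : rho g x ≤ 3 / 10) (s : ℝ) :
    w g (θ (s, x)) ∈ closedBall (0 : ℂ) 1 := by
  rw [mem_closedBall, dist_zero_right, norm_w_flowline_eq (hder x) (by rw [h0]; exact hx) s, h0]
  refine (sq_le_one_iff₀ (norm_nonneg _)).1 ?_
  have := eta_nonneg (‖cx x‖ ^ 2)
  rw [rho] at hx
  linarith

/-- **The page coordinate along a flow line depends only on its initial value** (uniqueness for
the autonomous ODE `ζ' = a(ζ) i ζ` in the unit disc): two points of `{rho ≤ 3/10}` with the same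
`w` have the same `w` at all times — the flow is FIBRED, pages go to pages simultaneously.
[cite: LeeSmoothManifolds2013, Thm. 9.12] -/
theorem w_flow_eq_of_w_eq (ha : ContDiff ℝ ∞ a) {x y : EuclideanSpace ℝ (Fin 4)}
    (hx : rho g x ≤ 3 / 10) (hy : rho g y ≤ 3 / 10) (hxy : w g x = w g y) (t : ℝ) :
    w g (θ (t, x)) = w g (θ (t, y)) := by
  obtain ⟨K, hK⟩ := exists_lipschitzOnWith_rotODE ha
  have key : (fun s => w g (θ (s, x))) = fun s => w g (θ (s, y)) :=
    ODE_solution_unique_univ (v := fun _ => rotODE a) (s := fun _ => closedBall (0 : ℂ) 1)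
      (t₀ := 0) (fun _ => hK)
      (fun s => ⟨hasDerivAt_w_flowline (hder x) (by rw [h0]; exact hx) s,
        w_flow_mem_closedBall hder h0 hx s⟩)
      (fun s => ⟨hasDerivAt_w_flowline (hder y) (by rw [h0]; exact hy) s,
        w_flow_mem_closedBall hder h0 hy s⟩)
      (by simp only [h0, hxy])
  exact congrFun key t

/-- **Comparison with an explicit solution**: if `f` solves `ζ' = a(ζ) i ζ` on `[0, 1]` inside the
unit disc with `f 0 = w x`, then `w (θ (1, x)) = f 1`. [cite: LeeSmoothManifolds2013, Thm. 9.12] -/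
theorem w_flow_one_eq (ha : ContDiff ℝ ∞ a) {x : EuclideanSpace ℝ (Fin 4)} (hx : rho g x ≤ 3 / 10)
    {f : ℝ → ℂ} (hfc : ContinuousOn f (Icc 0 1))
    (hf : ∀ t ∈ Ico (0 : ℝ) 1, HasDerivAt f (rotODE a (f t)) t)
    (hfb : ∀ t ∈ Ico (0 : ℝ) 1, ‖f t‖ ≤ 1) (hf0 : f 0 = w g x) :
    w g (θ (1, x)) = f 1 := by
  obtain ⟨K, hK⟩ := exists_lipschitzOnWith_rotODE ha
  have hw : ∀ s, HasDerivAt (fun s => w g (θ (s, x))) (rotODE a (w g (θ (s, x)))) s :=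
    fun s => hasDerivAt_w_flowline (hder x) (by rw [h0]; exact hx) s
  have key := ODE_solution_unique_of_mem_Icc_right (v := fun _ => rotODE a)
    (s := fun _ => closedBall (0 : ℂ) 1) (f := fun s => w g (θ (s, x))) (g := f) (a := 0) (b := 1)
    (fun _ _ => hK) (HasDerivAt.continuousOn fun s _ => hw s) (fun s _ => (hw s).hasDerivWithinAt)
    (fun s _ => w_flow_mem_closedBall hder h0 hx s) hfc (fun s hs => (hf s hs).hasDerivWithinAt)
    (fun s hs => mem_closedBall_zero_iff.2 (hfb s hs)) (by simp only [h0, hf0])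
  exact key ⟨zero_le_one, le_rfl⟩

end Flow

/-! ## §4 The explicit flow line of the dilation profile -/

/-- The angle schedule `α e^{λ t}` of the flow line starting at clockwise angle `α`. [folklore] -/
def angleFn (lam α t : ℝ) : ℝ := α * Real.exp (lam * t)

/-- The candidate flow line `e^{i α e^{λt}} / 2` of the page coordinate. [folklore] -/
def solFn (lam α t : ℝ) : ℂ := Complex.exp ((angleFn lam α t : ℝ) * Complex.I) / 2

/-- `(α e^{λt})' = λ · α e^{λt}`. [folklore] -/
theorem hasDerivAt_angleFn (lam α t : ℝ) :
    HasDerivAt (angleFn lam α) (lam * angleFn lam α t) t := by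
  exact ((((hasDerivAt_id t).const_mul lam).exp).const_mul α).congr_deriv
    (by simp only [angleFn, id]; ring)

/-- The candidate solves `ζ' = (λ · angle) · i ζ`. [folklore] -/
theorem hasDerivAt_solFn (lam α t : ℝ) :
    HasDerivAt (solFn lam α) (((lam * angleFn lam α t : ℝ) : ℂ) * (Complex.I * solFn lam α t)) t := by
  have h1 : HasDerivAt (fun s => ((angleFn lam α s : ℝ) : ℂ) * Complex.I)
      (((lam * angleFn lam α t : ℝ) : ℂ) * Complex.I) t :=
    (hasDerivAt_angleFn lam α t).ofReal_comp.mul_const Complex.I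
  have h2 : HasDerivAt (solFn lam α) (Complex.exp (((angleFn lam α t : ℝ) : ℂ) * Complex.I) *
      (((lam * angleFn lam α t : ℝ) : ℂ) * Complex.I) / 2) t := (h1.cexp).div_const 2
  exact h2.congr_deriv (by simp only [solFn]; ring)

/-- **Trigonometric separation from the ray**: an angle `φ ∈ [−2π + h, −h]` (`0 < h ≤ π/2`) has
`cos φ ≤ −(sin h)/2` or `sin² φ ≥ (sin h)²/4`. [folklore] -/
theorem cos_le_or_sin_sq_ge {h φ : ℝ} (hh : 0 < h) (hh' : h ≤ π / 2)
    (hφ : φ ∈ Icc (-(2 * π) + h) (-h)) :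
    Real.cos φ ≤ -(Real.sin h / 2) ∨ (Real.sin h / 2) ^ 2 ≤ Real.sin φ ^ 2 := by
  have hs0 : 0 < Real.sin h := Real.sin_pos_of_pos_of_lt_pi hh (by linarith)
  have hs1 : Real.sin h ≤ 1 := Real.sin_le_one h
  rcases le_or_gt (-(π / 2)) φ with h1 | h1
  · have : Real.sin φ ≤ Real.sin (-h) :=
      Real.sin_le_sin_of_le_of_le_pi_div_two h1 (by linarith) hφ.2
    rw [Real.sin_neg] at this
    right; nlinarith
  rcases le_or_gt φ (-(3 * π / 2)) with h2 | h2
  · have : Real.sin h ≤ Real.sin (φ + 2 * π) :=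
      Real.sin_le_sin_of_le_of_le_pi_div_two (by linarith) (by linarith) (by linarith [hφ.1])
    rw [Real.sin_add_two_pi] at this
    right; nlinarith
  · have hc : Real.cos φ < 0 := by
      have := Real.cos_pos_of_mem_Ioo (x := φ + π) ⟨by linarith, by linarith⟩
      rw [Real.cos_add_pi] at this
      linarith
    by_contra hcon
    rw [not_or, not_le, not_le] at hcon
    nlinarith [Real.sin_sq_add_cos_sq φ, hcon.1, hcon.2]

/-- On the arc `φ ∈ [−2π + h, −h]` the ray cut-off of width `δ = (sin h)/8` equals `1` at
`e^{iφ}/2`. [folklore] -/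
theorem rayCut_exp_div_two {h φ : ℝ} (hh : 0 < h) (hh' : h ≤ π / 2)
    (hφ : φ ∈ Icc (-(2 * π) + h) (-h)) :
    rayCut (Real.sin h / 8) (Complex.exp (φ * Complex.I) / 2) = 1 := by
  have hs0 : 0 < Real.sin h := Real.sin_pos_of_pos_of_lt_pi hh (by linarith)
  rcases cos_le_or_sin_sq_ge hh hh' hφ with hc | hsn
  · refine rayCut_eq_one_of_re (by positivity) ?_
    rw [Complex.div_ofNat_re, Complex.exp_ofReal_mul_I_re]
    linarith
  · refine rayCut_eq_one_of_im ?_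
    rw [Complex.div_ofNat_im, Complex.exp_ofReal_mul_I_im]
    nlinarith

/-- **The arc swept by a prefix letter**: for letter `i < m` of a word of length `K ≥ m`, the
angle schedule from `α_i = −2π(i+½)/K` at rate `λ = log(K/m)` stays in `[−2π + π/m, −π/K]`
during `t ∈ [0, 1]` (it decreases from `α_i` to `β_i = −2π(i+½)/m`). [folklore] -/
theorem angleFn_mem_Icc {m K i : ℕ} (hm : 0 < m) (hmK : m ≤ K) (hi : i < m) {t : ℝ}
    (ht : t ∈ Icc (0 : ℝ) 1) :
    angleFn (Real.log ((K : ℝ) / m)) (-(2 * π * (i + 1 / 2) / K)) t ∈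
      Icc (-(2 * π) + π / m) (-(π / K)) := by
  have hm' : (0 : ℝ) < m := Nat.cast_pos.2 hm
  have hK' : (0 : ℝ) < K := Nat.cast_pos.2 (hm.trans_le hmK)
  have hmK' : (m : ℝ) ≤ K := Nat.cast_le.2 hmK
  have hi' : (i : ℝ) + 1 ≤ m := by exact_mod_cast hi
  have hi0 : (0 : ℝ) ≤ i := Nat.cast_nonneg i
  have hlam : 0 ≤ Real.log ((K : ℝ) / m) := Real.log_nonneg ((one_le_div hm').2 hmK')
  have he1 : 1 ≤ Real.exp (Real.log ((K : ℝ) / m) * t) := Real.one_le_exp (mul_nonneg hlam ht.1)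
  have he2 : Real.exp (Real.log ((K : ℝ) / m) * t) ≤ K / m := by
    calc Real.exp (Real.log ((K : ℝ) / m) * t) ≤ Real.exp (Real.log ((K : ℝ) / m)) :=
          Real.exp_le_exp.2 (mul_le_of_le_one_right hlam ht.2)
      _ = K / m := Real.exp_log (div_pos hK' hm')
  have hα : -(2 * π * (i + 1 / 2) / (K : ℝ)) ≤ 0 := neg_nonpos.2 (by positivity)
  unfold angleFn
  constructor
  · have h1 : -(2 * π) + π / m ≤ -(2 * π * (i + 1 / 2) / (K : ℝ)) * (K / m) := by
      have e : -(2 * π * (i + 1 / 2) / (K : ℝ)) * (K / m) - (-(2 * π) + π / m) =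
          2 * π * (m - (i + 1)) / m := by field_simp; ring
      have : 0 ≤ 2 * π * (m - (i + 1)) / (m : ℝ) :=
        div_nonneg (mul_nonneg (by positivity) (by linarith)) hm'.le
      linarith
    exact h1.trans (mul_le_mul_of_nonpos_left he2 hα)
  · have h1 : -(2 * π * (i + 1 / 2) / (K : ℝ)) ≤ -(π / K) := by
      have e : -(π / K) - (-(2 * π * (i + 1 / 2) / (K : ℝ))) = 2 * π * i / K := by
        field_simp; ring
      have : 0 ≤ 2 * π * i / (K : ℝ) := by positivity
      linarith
    calc -(2 * π * (i + 1 / 2) / (K : ℝ)) * Real.exp (Real.log ((K : ℝ) / m) * t)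
        ≤ -(2 * π * (i + 1 / 2) / (K : ℝ)) * 1 := mul_le_mul_of_nonpos_left he1 hα
      _ ≤ -(π / K) := by rw [mul_one]; exact h1

/-! ## §5 The registered sub-goal: the page-rotation schedule -/

/-- **(T1b-1) The page-rotation schedule** (registered sub-goal `helper_exists_pageRotation` of
NF6): for a prefix of length `m ≥ 1` of a word of length `m + n` there is an ambient isotopy `R`
of the Lefschetz base `Base g` which (1) preserves every level of `rho`, (2) is FIBRED — at each
time every page `page g c` is carried into one page `page g c'` — and (3) at time `1` carries the
page of direction `pageDir (m + n) i` into that of direction `pageDir m i` for every prefix letter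
`i < m`: the flow (`helper_rotFlow_fix`) of the page-rotation field at the angular speed
`log((m+n)/m) ·` (clockwise angle), cut off near the unused direction `0` — the fibred isotopy of
`F × D²` re-spacing the page angles of a Lefschetz link.
[cite: Baykur2006, proof of Thm. 5.1, pp. 13–14] -/
theorem helper_exists_pageRotation : ∀ (g m n : ℕ), 0 < m → ∃ R :
    Literature.Topology.FourManifolds.AmbientIsotopy (𝓡∂ 4)
      (Literature.Topology.FourManifolds.LefschetzBase.Base g), (∀ (t : ℝ) (x :
      Literature.Topology.FourManifolds.LefschetzBase.Base g),
      Literature.Topology.FourManifolds.LefschetzBase.rho g (R.toFun t x).1 =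
        Literature.Topology.FourManifolds.LefschetzBase.rho g x.1) ∧ (∀ (t : ℝ) (c : ℂ), ‖c‖ = 1 →
      ∃ c' : ℂ, ‖c'‖ = 1 ∧ ∀ x : Literature.Topology.FourManifolds.LefschetzBase.Base g, x ∈
        Literature.Topology.FourManifolds.LefschetzBase.page g c → R.toFun t x ∈
          Literature.Topology.FourManifolds.LefschetzBase.page g c') ∧ (∀ i : ℕ, i < m → ∀ x :
      Literature.Topology.FourManifolds.LefschetzBase.Base g, x ∈
        Literature.Topology.FourManifolds.LefschetzBase.page g
          (Literature.Topology.FourManifolds.LefschetzBase.pageDir (m + n) i) → R.toFun 1 x ∈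
        Literature.Topology.FourManifolds.LefschetzBase.page g
          (Literature.Topology.FourManifolds.LefschetzBase.pageDir m i)) := by
  intro g m n hm
  -- the parameters of the dilation profile
  set K : ℕ := m + n with hK
  have hmK : m ≤ K := Nat.le_add_right m n
  have hK0 : 0 < K := hm.trans_le hmK
  have hm' : (0 : ℝ) < m := Nat.cast_pos.2 hm
  have hK' : (0 : ℝ) < K := Nat.cast_pos.2 hK0
  have hK1 : (1 : ℝ) ≤ K := by exact_mod_cast hK0
  have hmK' : (m : ℝ) ≤ K := Nat.cast_le.2 hmK
  set h : ℝ := π / (2 * K) with hh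
  have hh0 : 0 < h := by positivity
  have hh' : h ≤ π / 2 := div_le_div_of_nonneg_left Real.pi_pos.le (by norm_num) (by linarith)
  have hhm : h ≤ π / m := div_le_div_of_nonneg_left Real.pi_pos.le hm' (by linarith)
  have hhK : h ≤ π / K := div_le_div_of_nonneg_left Real.pi_pos.le hK' (by linarith)
  set δ : ℝ := Real.sin h / 8 with hδ
  have hsin : 0 < Real.sin h := Real.sin_pos_of_pos_of_lt_pi hh0 (by linarith [Real.pi_pos])
  have hδ0 : 0 < δ := by positivity
  set lam : ℝ := Real.log ((K : ℝ) / m) with hlam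
  have ha : ContDiff ℝ ∞ (dilProfile lam δ) := contDiff_dilProfile lam hδ0
  obtain ⟨R, θ, -, h0, -, hR, hder, hrho, -, -⟩ := helper_rotFlow_fix g (dilProfile lam δ) ha
  refine ⟨R, fun t x => by rw [hR, hrho], fun t c hc => ?_, fun i hi x hx => ?_⟩
  · -- clause 2: the isotopy is fibred
    by_cases hne : (page g c).Nonempty
    · obtain ⟨x₀, hx₀⟩ := hne
      have hρ₀ : rho g x₀.1 ≤ 3 / 10 := x₀.2.trans (by norm_num)
      refine ⟨2 * w g (θ (t, x₀.1)), ?_, fun x hx => ⟨?_, ?_⟩⟩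
      · rw [norm_mul, Complex.norm_two, norm_w_flowline_eq (hder x₀.1) (by rw [h0]; exact hρ₀) t,
          h0, hx₀.2, norm_div, hc, Complex.norm_two]
        norm_num
      · show ‖cx (R.toFun t x).1‖ ^ 2 < 4
        rw [hR, norm_sq_cx_flowline_lt_four_iff (hder x.1) t, h0]
        exact hx.1
      · show w g (R.toFun t x).1 = 2 * w g (θ (t, x₀.1)) / 2
        rw [hR, w_flow_eq_of_w_eq hder h0 ha (x.2.trans (by norm_num)) hρ₀
          (hx.2.trans hx₀.2.symm) t]
        ring
    · exact ⟨c, hc, fun x hx => absurd ⟨x, hx⟩ hne⟩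
  · -- clause 3: the prefix pages land on the standard directions at time `1`
    set α : ℝ := -(2 * π * (i + 1 / 2) / K) with hα
    have harc : ∀ t ∈ Icc (0 : ℝ) 1,
        angleFn lam α t ∈ Icc (-(2 * π) + h) (-h) ∧ angleFn lam α t ∈ Ioc (-(2 * π)) 0 := by
      intro t ht
      have hmem := angleFn_mem_Icc hm hmK hi ht
      exact ⟨⟨by linarith [hmem.1], by linarith [hmem.2]⟩, by linarith [hmem.1],
        by linarith [hmem.2]⟩
    -- along the candidate the profile is `λ ·` (clockwise angle): the candidate is a solution
    have hsol : ∀ t ∈ Ico (0 : ℝ) 1,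
        HasDerivAt (solFn lam α) (rotODE (dilProfile lam δ) (solFn lam α t)) t := by
      intro t ht
      obtain ⟨h1, h2⟩ := harc t (Ico_subset_Icc_self ht)
      rw [rotODE, dilProfile, solFn, cwAngle_exp_div_two h2, hδ, rayCut_exp_div_two hh0 hh' h1,
        mul_one]
      exact hasDerivAt_solFn lam α t
    -- so the page coordinate of the flow line from `x` is the candidate
    have hw1 : w g (θ (1, x.1)) = solFn lam α 1 :=
      w_flow_one_eq hder h0 ha (x.2.trans (by norm_num))
        (HasDerivAt.continuousOn fun t _ => hasDerivAt_solFn lam α t) hsol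
        (fun t _ => by rw [solFn, norm_div, Complex.norm_exp_ofReal_mul_I, Complex.norm_two]; norm_num)
        (by rw [hx.2, solFn, angleFn, pageDir, mul_zero, Real.exp_zero, mul_one])
    refine ⟨?_, ?_⟩
    · show ‖cx (R.toFun 1 x).1‖ ^ 2 < 4
      rw [hR, norm_sq_cx_flowline_lt_four_iff (hder x.1) 1, h0]
      exact hx.1
    · show w g (R.toFun 1 x).1 = pageDir m i / 2
      rw [hR, hw1, solFn, pageDir, angleFn, mul_one, hlam, Real.exp_log (div_pos hK' hm'), hα]
      congr 4
      field_simp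

end Summit.SmoothPoincare4.SmoothPoincare4.Theorems.AcyclicBisectionExists.ModpBraidOrbits
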